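import Summits.QuantumAdvantage.AdviceFreeQNC0.AffBells26MoveSystems
import Summits.QuantumAdvantage.AdviceFreeQNC0.AffBells26CubeTarget
import HarnessLib

/-!
# `AffBells26.CreationsMoveSystem` PROVED — the creations of an admissible cube form a move system (planner qn-p1 g26, Sketch26 tail)

Prover seat qn-prover-3 g14.  **`creationsMoveSystem : CreationsMoveSystem`**: for an odd input `x` (`N ≥ 4`) and an admissible set `A`
of creation centres, the moves `j ↦ (F j, O j) = ({a_j − 1, a_j + 1}, {a_j})`, `a_j = A.orderEmbOfFin rfl j`, satisfy the move-system
axioms `AffBells26.MoveSystem`: every cube point is odd with kernel line `J ⊕ 1_{owned set}` (iterated creation, `kline_xS₄` — the landed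
`kline_xS` with its hypothesis relaxed to `N ≥ 4`, which is all `Fib19.kline_create` needs), the flip / owned sets are pairwise disjoint
(`disjoint_flipSet`, admissibility), and flipped bits are active.  So the instance family behind Q1
(`cubeIdentity`) is a genuine instance of the move-agnostic Q1-gen (`cubeIdentityGen`) / `cubeTargetEven`.
WHAT THIS IS NOT: instrument for crux stmt-QuantumAdvantage-22907 (route DWalkThree); separation NOT moved.
-/

namespace Summit.QuantumAdvantage.AdviceFreeQNC0

namespace AffBells26

open Finset Literature.Computability.QuantumComplexity Literature.Computability.QuantumComplexity.RingHLF
open AffBells23 Fib19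

variable {N : ℕ}

/-- **Iterated coin creation** for `N ≥ 4` (the landed `kline_xS`, verbatim proof, hypothesis relaxed). -/
theorem kline_xS₄ (hN : 4 ≤ N) (x : Fin N → Bool) (hodd : IsOdd x) {A : Finset (Fin N)} (hA : Admissible x A) :
    ∀ S, S ⊆ A → IsOdd (xS x S) ∧ kline (xS x S) = flipAt (kline x) S := by
  classical
  intro S
  induction S using Finset.induction_on with
  | empty =>
    intro _
    unfold xS
    rw [flipSet_empty, flipAt_empty', flipAt_empty']
    exact ⟨hodd, rfl⟩
  | insert a S haS ih =>
    intro hsub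
    have ha : a ∈ A := hsub (mem_insert_self a S)
    have hS : S ⊆ A := fun i hi => hsub (mem_insert_of_mem hi)
    obtain ⟨hoddS, hkS⟩ := ih hS
    obtain ⟨hp, hn'⟩ := not_mem_of_admissible hA ha hS haS
    have hxS : xS x (insert a S) = flipAt (xS x S) {prv a, nxt a} := by
      unfold xS
      rw [flipSet_insert, union_comm, flipAt_flipAt_of_disjoint x (disjoint_flipSet hA ha hS haS)]
    obtain ⟨h1, h2, h3⟩ := hA.1 a ha
    have hc := kline_create hN (xS x S) hoddS a
      (by rw [hkS, flipAt_apply_of_not_mem hp, h1]) (by rw [hkS, flipAt_apply_of_not_mem haS, h2])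
      (by rw [hkS, flipAt_apply_of_not_mem hn', h3])
    rw [hxS]
    refine ⟨hc.1, ?_⟩
    rw [hc.2, hkS, flipAt_flipAt_of_disjoint _ (disjoint_singleton_right.2 haS), union_comm, ← insert_eq]

/-- The cube point of the creation move system is the iterated creation `xS` at the image centres. -/
theorem xF_creations (x : Fin N → Bool) (A : Finset (Fin N)) (S : Finset (Fin A.card)) :
    xF x (fun j : Fin A.card => ({prv (A.orderEmbOfFin rfl j), nxt (A.orderEmbOfFin rfl j)} : Finset (Fin N))) S =
      xS x (S.map (A.orderEmbOfFin rfl).toEmbedding) := by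
  classical
  unfold xF xS flipSet
  congr 1
  ext i
  simp only [mem_biUnion, mem_map, RelEmbedding.coe_toEmbedding]
  constructor
  · rintro ⟨j, hj, hi⟩
    exact ⟨A.orderEmbOfFin rfl j, ⟨j, hj, rfl⟩, hi⟩
  · rintro ⟨a, ⟨j, hj, rfl⟩, hi⟩
    exact ⟨j, hj, hi⟩

/-- **`CreationsMoveSystem`**: the creations of an admissible cube form a move system. -/
theorem creationsMoveSystem : CreationsMoveSystem := by
  classical
  intro N hN x A hodd hA
  set e := A.orderEmbOfFin rfl with he
  have heA : ∀ j : Fin A.card, e j ∈ A := fun j => A.orderEmbOfFin_mem rfl j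
  have hinj : ∀ j j' : Fin A.card, j ≠ j' → e j ≠ e j' := fun j j' hne h => hne (e.injective h)
  refine ⟨hodd, fun S => ?_, fun j j' hne => ⟨?_, ?_⟩, fun j j' => ?_, fun j b hb => ?_⟩
  · -- cube points: odd, kernel line toggled on the owned centres
    have hsub : S.map e.toEmbedding ⊆ A := by
      intro a ha
      rw [mem_map] at ha
      obtain ⟨j, _, rfl⟩ := ha
      exact heA j
    obtain ⟨hoddS, hkS⟩ := kline_xS₄ hN x hodd hA _ hsub
    rw [xF_creations, hkS] at *
    refine ⟨hoddS, fun i => ?_⟩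
    unfold flipAt
    congr 1
    by_cases hi : i ∈ S.map e.toEmbedding
    · rw [decide_eq_true hi, decide_eq_true]
      rw [mem_map] at hi
      obtain ⟨j, hj, hji⟩ := hi
      exact ⟨j, hj, by rw [mem_singleton]; exact hji.symm⟩
    · rw [decide_eq_false hi, decide_eq_false]
      rintro ⟨j, hj, hij⟩
      rw [mem_singleton] at hij
      exact hi (mem_map.2 ⟨j, hj, hij.symm⟩)
  · -- flip sets of distinct creations are disjoint
    have h := disjoint_flipSet hA (heA j') (S := {e j}) (singleton_subset_iff.2 (heA j))
      (by rw [mem_singleton]; exact (hinj j j' hne).symm)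
    unfold flipSet at h
    rwa [singleton_biUnion] at h
  · -- owned centres are distinct
    exact disjoint_singleton.2 (hinj j j' hne)
  · -- a centre is never a flipped bit
    rw [disjoint_singleton_right, mem_insert, mem_singleton]
    by_cases hjj : j = j'
    · subst hjj
      rintro (h | h)
      · have hne := nxt_ne_self (by omega) (prv (e j))
        rw [nxt_prv] at hne
        exact hne h
      · exact nxt_ne_self (by omega) (e j) h.symm
    · obtain ⟨h1, -, h3, -⟩ := hA.2 (e j) (heA j) (e j') (heA j') (hinj j j' hjj)
      rintro (h | h)
      · exact h3 h
      · exact h1 h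
  · -- flipped bits are active
    obtain ⟨h1, -, h3⟩ := hA.1 (e j) (heA j)
    rw [mem_insert, mem_singleton] at hb
    rcases hb with rfl | rfl
    · exact h1
    · exact h3

end AffBells26

end Summit.QuantumAdvantage.AdviceFreeQNC0
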